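import Mathlib.GroupTheory.Torsion
import Mathlib.Data.Set.Finite.Basic
import Mathlib.SetTheory.Cardinal.Finite
import Mathlib.Tactic.Abel
import HarnessLib

/-!
# Crux `PrintCf2.SplitBadTwoRankOneOfFacts` (item stmt-BirchSwinnertonDyer-20368), road α, S3c₂: a `p`-primary group with CYCLIC `p`-torsion is
# COCYCLIC — every infinite subgroup is everything, every proper subgroup is finite (pure algebra)

Cell `bsd-print-cf2`, width seat `bsd-line-cf2-p1-w8` g2 (brick **B6h**, part 4: the algebra behind -w7 g2's `hcocyc` and (H2));
`--supports stmt-BirchSwinnertonDyer-20368` (helper, Theses-free). HONEST FRAMING: nothing here closes a crux or a stub; BSD is not proved by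
any of this; no summit statement is proved by this seat. No definition, no named fact, no `sorry`. beyond-print theorem: no.

WHY. -w7 g2's `r = 1` mechanism for (H2) (`le_of_forall_lt_finite_of_infinite`, p662108) and `natCard_restrictedSelmerBase_eq_three_mul_of_cocyclic`
display «every proper subgroup of `Q′` is finite» (`Q′` = the local Kummer image `E(K_𝔭) ⊗ ℚ_p/ℤ_p ≅ ℚ_p/ℤ_p`). The local input the tree can
hope to supply is weaker-looking: «`Q′` is `p`-primary with cyclic `p`-torsion» ((T-loc), cf. -w3 g9's hcyc and p674679's (P-cyc)). This file
proves the pure group theory closing the gap: for a `p`-primary subgroup `G` of an abelian group whose `p`-torsion is cyclic («every non-zero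
`x ∈ G[p]` generates `G[p]`»),
* `mem_zmultiples_of_exact_order` — an element of exact order `p^m` generates `G[p^m]` (induction on `m`);
* `finite_torsionBy_pow_of_cyclic` — each `G[p^m]` is finite;
* **`le_of_not_finite_of_cyclic_torsion`** — every infinite subgroup `H ≤ G` equals `G`;
* **`forall_lt_finite_of_cyclic_torsion`** — every proper subgroup of `G` is finite (-w7 g2's `hcocyc`, VERBATIM shape).

References: standard (Prüfer groups); used as in A. Agboola, Compositio 143 (2007) Lemma 6.3(b), Prop. 6.11 [Agboola2007].
-/

set_option linter.dupNamespace false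
set_option autoImplicit false

namespace Summit.BirchSwinnertonDyer.BirchSwinnertonDyer.Theorems.PrintCf2.CMPrimes

section Cocyclic

variable {B : Type*} [AddCommGroup B] {p : ℕ}

/-- **An element of exact order `p^m` generates `G[p^m]`** in a subgroup `G` with cyclic `p`-torsion: if `p^m h = 0 ≠ p^{m-1} h`… stated as
`p ^ m • h = 0` and `∀ j < m, p ^ j • h ≠ 0`-free form: by induction on `m`, with `h` of exact order `p^m` meaning `p^m h = 0` and
`p^(m-1) h ≠ 0` for `m ≥ 1`. [cite: Agboola2007, Lemma 6.3 (b)] -/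
theorem mem_zmultiples_of_exact_order (G : AddSubgroup B)
    (hcyc : ∀ x ∈ G, ∀ y ∈ G, p • x = 0 → p • y = 0 → x ≠ 0 → ∃ m : ℤ, y = m • x) :
    ∀ (m : ℕ) (h : B), h ∈ G → p ^ (m + 1) • h = 0 → p ^ m • h ≠ 0 →
      ∀ g ∈ G, p ^ (m + 1) • g = 0 → ∃ a : ℤ, g = a • h := by
  intro m
  induction m with
  | zero =>
    intro h hh hph hh0 g hg hpg
    rw [zero_add, pow_one] at hph hpg
    rw [pow_zero, one_smul] at hh0
    exact hcyc h hh g hg hph hpg hh0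
  | succ m ih =>
    intro h hh hph hh0 g hg hpg
    -- `p • g`, `p • h` lie in `G[p^(m+1)]`, `p • h` has exact order `p^(m+1)`
    have hph' : p ^ (m + 1) • (p • h) = 0 := by rw [← mul_smul, ← pow_succ, hph]
    have hh0' : p ^ m • (p • h) ≠ 0 := by rw [← mul_smul, ← pow_succ]; exact hh0
    have hpg' : p ^ (m + 1) • (p • g) = 0 := by rw [← mul_smul, ← pow_succ, hpg]
    obtain ⟨a, ha⟩ := ih (p • h) (G.nsmul_mem hh p) hph' hh0' (p • g) (G.nsmul_mem hg p) hpg'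
    -- `p (g - a h) = 0`
    have hdiff : p • (g - a • h) = 0 := by rw [smul_sub, ha, smul_comm, sub_self]
    -- `p^(m+1) h ∈ G[p]` is non-zero
    have hq : p • (p ^ (m + 1) • h) = 0 := by rw [← mul_smul, mul_comm, ← pow_succ, hph]
    obtain ⟨b, hb⟩ := hcyc (p ^ (m + 1) • h) (G.nsmul_mem hh _) (g - a • h) (G.sub_mem hg (G.zsmul_mem hh a)) hq hdiff hh0
    refine ⟨a + b * (p ^ (m + 1) : ℕ), ?_⟩
    rw [add_smul, mul_smul, natCast_zsmul, ← hb]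
    abel

/-- **`G[p^m]` is finite** when `G` has cyclic `p`-torsion: either there is an element of exact order `p^m`, which generates `G[p^m]`
(at most `p^m` multiples), or `G[p^m] = G[p^(m-1)]`. [cite: Agboola2007, Lemma 6.3 (b)] -/
theorem finite_torsionBy_pow_of_cyclic (hp : 0 < p) (G : AddSubgroup B)
    (hcyc : ∀ x ∈ G, ∀ y ∈ G, p • x = 0 → p • y = 0 → x ≠ 0 → ∃ m : ℤ, y = m • x) :
    ∀ m : ℕ, Set.Finite {g : B | g ∈ G ∧ p ^ m • g = 0} := by
  intro m
  induction m with
  | zero =>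
    refine (Set.finite_singleton (0 : B)).subset ?_
    rintro g ⟨-, hg⟩
    rw [pow_zero, one_smul] at hg
    exact hg
  | succ m ih =>
    by_cases hex : ∃ h ∈ G, p ^ (m + 1) • h = 0 ∧ p ^ m • h ≠ 0
    · obtain ⟨h, hh, hph, hh0⟩ := hex
      -- every element of `G[p^(m+1)]` is `a • h` with `0 ≤ a < p^(m+1)`
      have hsub : {g : B | g ∈ G ∧ p ^ (m + 1) • g = 0} ⊆
          (fun a : Fin (p ^ (m + 1)) ↦ ((a : ℕ) : ℤ) • h) '' Set.univ := by
        rintro g ⟨hg, hpg⟩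
        obtain ⟨a, rfl⟩ := mem_zmultiples_of_exact_order G hcyc m h hh hph hh0 g hg hpg
        have hpos : (0 : ℤ) < (p ^ (m + 1) : ℕ) := by exact_mod_cast pow_pos hp _
        refine ⟨⟨(a % (p ^ (m + 1) : ℕ)).toNat, ?_⟩, Set.mem_univ _, ?_⟩
        · have h1 := Int.emod_lt_of_pos a hpos
          have h0 := Int.emod_nonneg a hpos.ne'
          omega
        · have h0 := Int.emod_nonneg a hpos.ne'
          simp only
          rw [Int.toNat_of_nonneg h0]
          -- `a • h = (a % p^(m+1)) • h` since `p^(m+1) • h = 0`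
          conv_rhs => rw [← Int.emod_add_mul_ediv a (p ^ (m + 1) : ℕ)]
          rw [add_smul, mul_comm, mul_smul, natCast_zsmul, hph, smul_zero, add_zero]
      exact (Set.finite_univ.image _).subset hsub
    · -- no element of exact order `p^(m+1)`: `G[p^(m+1)] = G[p^m]`
      refine ih.subset ?_
      rintro g ⟨hg, hpg⟩
      refine ⟨hg, ?_⟩
      by_contra hne
      exact hex ⟨g, hg, hpg, hne⟩

/-- **An infinite subgroup of a `p`-primary group with cyclic `p`-torsion is everything.** `G ≤ B` `p`-primary with cyclic `p`-torsion,
`H ≤ G` infinite ⟹ `G ≤ H`: for `g ∈ G[p^m]`, `H ⊄ G[p^m]` (finite) gives `h ∈ H` of exact order `p^n`, `n > m`; then `p^(n-m) h ∈ H` has exact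
order `p^m` and generates `G[p^m] ∋ g`. [cite: Agboola2007, Lemma 6.3 (b), Prop. 6.11 (arXiv p0014:L1–20)] -/
theorem le_of_not_finite_of_cyclic_torsion (hp : 0 < p) (G H : AddSubgroup B) (hHG : H ≤ G)
    (hprim : ∀ g ∈ G, ∃ n : ℕ, p ^ n • g = 0)
    (hcyc : ∀ x ∈ G, ∀ y ∈ G, p • x = 0 → p • y = 0 → x ≠ 0 → ∃ m : ℤ, y = m • x)
    (hinf : ¬ Finite H) : G ≤ H := by
  intro g hg
  obtain ⟨m, hm⟩ := hprim g hg
  -- an element of `H` outside the finite `G[p^m]`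
  have hex : ∃ h ∈ H, p ^ m • h ≠ 0 := by
    by_contra hall
    simp only [not_exists, not_and, not_not] at hall
    apply hinf
    have hfin := finite_torsionBy_pow_of_cyclic hp G hcyc m
    have hsub : (H : Set B) ⊆ {g : B | g ∈ G ∧ p ^ m • g = 0} := fun h hh ↦ ⟨hHG hh, hall h hh⟩
    exact (hfin.subset hsub).to_subtype
  obtain ⟨h, hh, hh0⟩ := hex
  -- exact order of `h`: `p^n h = 0`, `n` minimal; `n ≥ m + 1`
  have hex2 : ∃ n : ℕ, p ^ n • h = 0 := hprim h (hHG hh)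
  classical
  set n := Nat.find hex2 with hndef
  have hn : p ^ n • h = 0 := Nat.find_spec hex2
  have hnmin : ∀ j < n, p ^ j • h ≠ 0 := fun j hj ↦ Nat.find_min hex2 hj
  have hmn : m < n := by
    by_contra hle
    rw [not_lt] at hle
    apply hh0
    obtain ⟨d, rfl⟩ := Nat.exists_eq_add_of_le hle
    rw [pow_add, mul_comm, mul_smul, hn, smul_zero]
  -- the case `m = 0` is trivial
  rcases Nat.eq_zero_or_pos m with rfl | hmpos
  · rw [pow_zero, one_smul] at hm
    rw [hm]
    exact H.zero_mem
  -- `h' := p^(n-m) • h ∈ H` has exact order `p^m`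
  obtain ⟨d, hd⟩ := Nat.exists_eq_add_of_le hmn.le
  set h' := p ^ d • h with hh'def
  have hh'H : h' ∈ H := H.nsmul_mem hh _
  have h1 : p ^ m • h' = 0 := by rw [hh'def, ← mul_smul, ← pow_add, ← hd, hn]
  obtain ⟨m₀, rfl⟩ : ∃ m₀, m = m₀ + 1 := ⟨m - 1, (Nat.sub_add_cancel hmpos).symm⟩
  have h2 : p ^ m₀ • h' ≠ 0 := by
    rw [hh'def, ← mul_smul, ← pow_add]
    refine hnmin _ ?_
    omega
  obtain ⟨a, rfl⟩ := mem_zmultiples_of_exact_order G hcyc m₀ h' (hHG hh'H) h1 h2 g hg hm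
  exact H.zsmul_mem hh'H a

/-- **Every proper subgroup of a `p`-primary group with cyclic `p`-torsion is finite** — the `hcocyc` hypothesis of -w7 g2's
`le_of_forall_lt_finite_of_infinite` / `natCard_restrictedSelmerBase_eq_three_mul_of_cocyclic`, from (T-loc)-type cyclicity.
[cite: Agboola2007, Lemma 6.3 (b), Prop. 6.11 (arXiv p0014:L1–20)] -/
theorem forall_lt_finite_of_cyclic_torsion (hp : 0 < p) (G : AddSubgroup B)
    (hprim : ∀ g ∈ G, ∃ n : ℕ, p ^ n • g = 0)
    (hcyc : ∀ x ∈ G, ∀ y ∈ G, p • x = 0 → p • y = 0 → x ≠ 0 → ∃ m : ℤ, y = m • x) :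
    ∀ H : AddSubgroup B, H < G → Finite H := by
  intro H hlt
  by_contra hinf
  exact hlt.ne (le_antisymm hlt.le (le_of_not_finite_of_cyclic_torsion hp G H hlt.le hprim hcyc hinf))

end Cocyclic

end Summit.BirchSwinnertonDyer.BirchSwinnertonDyer.Theorems.PrintCf2.CMPrimes
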